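import Summits.KontsevichZagierPeriods.KontsevichZagierPeriods.Theses.HurwitzMicroSectors
import Summits.KontsevichZagierPeriods.KontsevichZagierPeriods.Theorems.HurwitzMicroSectorsNormalFormPrinciplePiBoxTransfer
import Summits.KontsevichZagierPeriods.KontsevichZagierPeriods.Theorems.HurwitzMicroSectorsNormalFormPrincipleVariants2320

/-! TTRL-lite variant V2299 of stmt-KontsevichZagierPeriods-3869

Variant V2299 = `stub_boxRigidity` (BoxRigidity: two box-rational representations — domain the open
unit box, integrand `p/q` with `p, q` over `ℚ` — with equal values are KZ-equivalent) under the move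
`fix_nat:m=5; bound_nat:m'≤8` (left dimension frozen to `5`, right dimension bounded by `8`). Verdict
of the attempt seat: **open** — this file is the exact-strength certificate, not a proof of the variant.
By the tree's general fact `boxRigidityFixBound_iff_boxVanishing_snd` (file `…Variants2320`: freezing
one dimension to `K` and bounding the other by `b ≥ K` is exactly BoxVanishing in dimension `b`),
V2299 is **BoxVanishing(`8`)** — every box-rational representation on `(0,1)⁸` of value `0` is a KZ
relation (`stub_boxRigidity_var2299_iff_boxVanishing_eight`) —, equivalently BoxRigidity under the
joint bound `m, m' ≤ 8` (`stub_boxRigidity_var2299_iff_le_eight`, literally the sibling V2336), and it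
coincides with the sibling V2320 (`fix_nat:m=8; bound_nat:m'≤2`, `stub_boxRigidity_var2299_iff_var2320`).
That is Conjecture 1 of Kontsevich–Zagier for all pairs of rational integrands on the boxes
`(0,1)^{≤ 8}` (periods `π²`, …, `π⁸`, `ζ(3)`, `ζ(5)`, `ζ(7)`, `ζ(3)ζ(5)`, every MZV of weight `≤ 8`,
Catalan's `G`, `Li₂` at rationals, …); already its dimension-`3` part contains the representations
`[1/(1 − xyz) − a − b/(1 − xy)]`, `a, b ∈ ℚ`, whose case `value = 0` is `ζ(3) = a + bζ(2)` — nothing in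
the tree or in print settles it; the proved two-sided instance is `m, m' ≤ 1` (`boxRigidity_of_le_one`,
Baker). Upward `KontsevichZagierPeriods ⇒ parent ⇒ V2299` (`stub_boxRigidity_var2299_of_statement`),
so a refutation of the variant would refute the Summit, and the tree has no invariant of
`KZ.relations` finer than `eval`. Source: M. Kontsevich, D. Zagier, *Periods* (2001), §1.2
Conjecture 1. Pure proof file, no definitions. -/

-- `Summit.<Summit>.<Problem>` is the tree's mandated summit-side namespace (CONVENTIONS §2); for this
-- single-conjunct summit the two coincide, so the duplicate is deliberate.
set_option linter.dupNamespace false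

noncomputable section

namespace Summit.KontsevichZagierPeriods.KontsevichZagierPeriods.Theorems

open MeasureTheory Set
open Literature.NumberTheory.Transcendental Literature.NumberTheory.Transcendental.KZ
open Summit.KontsevichZagierPeriods.KontsevichZagierPeriods.Theses.HurwitzMicroSectors
open Summit.KontsevichZagierPeriods.HurwitzMicroSectors.NormalFormPrinciple.PiBox

/-! ## The variant V2299 is exactly `BoxVanishing 8` -/

/-- **V2299 ⟺ BoxVanishing in dimension `8`** (every box-rational representation on `(0,1)⁸` of value
`0` is a KZ relation): instance `K = 5 ≤ b = 8` of `boxRigidityFixBound_iff_boxVanishing_snd` — forward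
by comparing the zero representation on `(0,1)⁵` with a vanishing box-rational representation on
`(0,1)⁸`, backward by padding both sides to `(0,1)⁸` and subtracting.
[cite: KontsevichZagier2001, §1.2 Conjecture 1] -/
theorem stub_boxRigidity_var2299_iff_boxVanishing_eight :
    (∀ (m' : ℕ) (N : IntegralRep 5) (N' : IntegralRep m'), m' ≤ 8 → N.domain = {x | ∀ i, x i ∈ Set.Ioo (0:ℝ) 1} → N.IsRational → N'.domain = {x | ∀ i, x i ∈ Set.Ioo (0:ℝ) 1} → N'.IsRational → N.value = N'.value → Equivalent N N') ↔
    (∀ (N : IntegralRep 8), N.domain = {x | ∀ i, x i ∈ Set.Ioo (0:ℝ) 1} → N.IsRational →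
      N.value = 0 → of N ∈ relations) :=
  boxRigidityFixBound_iff_boxVanishing_snd (by norm_num)

/-- **V2299 ⟺ BoxRigidity under the joint bound `m, m' ≤ 8`** (the honest strength of the variant,
literally the two-sided sibling V2336 `bound_nat:m≤8; bound_nat:m'≤8`: Conjecture 1 for all pairs of
rational integrands on the open unit boxes of dimension at most `8`; freezing `m := 5` loses nothing
against the bound `m' ≤ 8`). [cite: KontsevichZagier2001, §1.2 Conjecture 1] -/
theorem stub_boxRigidity_var2299_iff_le_eight :
    (∀ (m' : ℕ) (N : IntegralRep 5) (N' : IntegralRep m'), m' ≤ 8 → N.domain = {x | ∀ i, x i ∈ Set.Ioo (0:ℝ) 1} → N.IsRational → N'.domain = {x | ∀ i, x i ∈ Set.Ioo (0:ℝ) 1} → N'.IsRational → N.value = N'.value → Equivalent N N') ↔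
    (∀ (m m' : ℕ) (N : IntegralRep m) (N' : IntegralRep m'), m' ≤ 8 → m ≤ 8 →
      N.domain = {x | ∀ i, x i ∈ Set.Ioo (0:ℝ) 1} → N.IsRational →
      N'.domain = {x | ∀ i, x i ∈ Set.Ioo (0:ℝ) 1} → N'.IsRational →
      N.value = N'.value → Equivalent N N') :=
  ⟨fun h => boxRigidityLe_of_boxVanishing (j := 8) (k := 8) le_rfl le_rfl
      (stub_boxRigidity_var2299_iff_boxVanishing_eight.1 h),
    fun h m' N N' hm' => h 5 m' N N' hm' (by norm_num)⟩

/-- **V2299 ⟺ the sibling V2320** (`fix_nat:m=8; bound_nat:m'≤2`): both are `BoxVanishing 8`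
(`stub_boxRigidity_var2320_iff_boxVanishing_eight`, file `…Variants2320`).
[cite: KontsevichZagier2001, §1.2 Conjecture 1] -/
theorem stub_boxRigidity_var2299_iff_var2320 :
    (∀ (m' : ℕ) (N : IntegralRep 5) (N' : IntegralRep m'), m' ≤ 8 → N.domain = {x | ∀ i, x i ∈ Set.Ioo (0:ℝ) 1} → N.IsRational → N'.domain = {x | ∀ i, x i ∈ Set.Ioo (0:ℝ) 1} → N'.IsRational → N.value = N'.value → Equivalent N N') ↔
    (∀ (m' : ℕ) (N : IntegralRep 8) (N' : IntegralRep m'), m' ≤ 2 → N.domain = {x | ∀ i, x i ∈ Set.Ioo (0:ℝ) 1} → N.IsRational → N'.domain = {x | ∀ i, x i ∈ Set.Ioo (0:ℝ) 1} → N'.IsRational → N.value = N'.value → Equivalent N N') :=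
  stub_boxRigidity_var2299_iff_boxVanishing_eight.trans
    stub_boxRigidity_var2320_iff_boxVanishing_eight.symm

/-- **V2299 with the frozen side free**: since the variant is `BoxVanishing 8`, the frozen dimension
`5` may be replaced by any bound `m ≤ 8` and the two dimension hypotheses swapped — the programmatic
move changes nothing below dimension `8`. [cite: KontsevichZagier2001, §1.2 Conjecture 1] -/
theorem stub_boxRigidity_var2299_iff_swap :
    (∀ (m' : ℕ) (N : IntegralRep 5) (N' : IntegralRep m'), m' ≤ 8 → N.domain = {x | ∀ i, x i ∈ Set.Ioo (0:ℝ) 1} → N.IsRational → N'.domain = {x | ∀ i, x i ∈ Set.Ioo (0:ℝ) 1} → N'.IsRational → N.value = N'.value → Equivalent N N') ↔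
    (∀ (m : ℕ) (N : IntegralRep m) (N' : IntegralRep 5), m ≤ 8 →
      N.domain = {x | ∀ i, x i ∈ Set.Ioo (0:ℝ) 1} → N.IsRational →
      N'.domain = {x | ∀ i, x i ∈ Set.Ioo (0:ℝ) 1} → N'.IsRational →
      N.value = N'.value → Equivalent N N') := by
  rw [stub_boxRigidity_var2299_iff_le_eight]
  refine ⟨fun h m N N' hm => h m 5 N N' (by norm_num) hm, fun h m m' N N' hm' hm hNd hNr hN'd hN'r hv => ?_⟩
  have hvan : ∀ (M : IntegralRep 8), M.domain = {x | ∀ i, x i ∈ Set.Ioo (0:ℝ) 1} → M.IsRational →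
      M.value = 0 → of M ∈ relations := by
    intro M hMd hMr hMv
    obtain ⟨Z, hZd, hZi⟩ := exists_zeroRep (isSemialgebraic_box 5)
    have hZ : of Z ∈ relations := of_mem_relations_of_eqOn_zero Z (by simp [hZi, EqOn])
    have hZv : Z.value = 0 := by simp [IntegralRep.value, hZi]
    have hZr : Z.IsRational := ⟨0, 1, fun x _ => by simp, fun x _ => by simp [hZi]⟩
    have hMZ : of M - of Z ∈ relations := h 8 M Z le_rfl hMd hMr hZd hZr (by rw [hMv, hZv])
    have := relations.add_mem hMZ hZ
    rwa [sub_add_cancel] at this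
  exact boxRigidityLe_of_boxVanishing (j := 8) (k := 8) le_rfl le_rfl hvan m m' N N' hm' hm hNd hNr
    hN'd hN'r hv

/-- **V2299 ⇒ BoxVanishing in every dimension `≤ 8`** (monotonicity along padding,
`boxVanishing_mono`); the first open level is `2` (every vanishing absolutely convergent
`∫∫_{(0,1)²} p/q`, `p/q ∈ ℚ(x, y)`, is generated by the four moves: Catalan / dilogarithm relations).
[cite: KontsevichZagier2001, §1.2 Conjecture 1] -/
theorem boxVanishing_le_eight_of_stub_boxRigidity_var2299
    (h : ∀ (m' : ℕ) (N : IntegralRep 5) (N' : IntegralRep m'), m' ≤ 8 → N.domain = {x | ∀ i, x i ∈ Set.Ioo (0:ℝ) 1} → N.IsRational → N'.domain = {x | ∀ i, x i ∈ Set.Ioo (0:ℝ) 1} → N'.IsRational → N.value = N'.value → Equivalent N N')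
    {m : ℕ} (hm : m ≤ 8) (N : IntegralRep m) (hNd : N.domain = {x | ∀ i, x i ∈ Set.Ioo (0:ℝ) 1})
    (hNr : N.IsRational) (hv : N.value = 0) : of N ∈ relations :=
  boxVanishing_mono hm (stub_boxRigidity_var2299_iff_boxVanishing_eight.1 h) N hNd hNr hv

/-- **The parent leaf ⇒ V2299** (specialisation `m := 5`, the bound `m' ≤ 8` is dropped; the converse
is not claimed — the parent is `BoxVanishing` in ALL dimensions). [cite: KontsevichZagier2001, §1.2 Conjecture 1] -/
theorem stub_boxRigidity_var2299_of_parent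
    (h : ∀ (m m' : ℕ) (N : IntegralRep m) (N' : IntegralRep m'), N.domain = {x | ∀ i, x i ∈ Set.Ioo (0:ℝ) 1} → N.IsRational → N'.domain = {x | ∀ i, x i ∈ Set.Ioo (0:ℝ) 1} → N'.IsRational → N.value = N'.value → Equivalent N N') :
    ∀ (m' : ℕ) (N : IntegralRep 5) (N' : IntegralRep m'), m' ≤ 8 → N.domain = {x | ∀ i, x i ∈ Set.Ioo (0:ℝ) 1} → N.IsRational → N'.domain = {x | ∀ i, x i ∈ Set.Ioo (0:ℝ) 1} → N'.IsRational → N.value = N'.value → Equivalent N N' :=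
  fun m' N N' _ => h 5 m' N N'

/-- **`KontsevichZagierPeriods ⇒ V2299`**: the variant is a special case of Conjecture 1 for the
tree's calculus (`leaves_of_statement`) — so a refutation of the variant would refute the Summit.
[cite: KontsevichZagier2001, §1.2 Conjecture 1] -/
theorem stub_boxRigidity_var2299_of_statement (h : _root_.KontsevichZagierPeriods) :
    ∀ (m' : ℕ) (N : IntegralRep 5) (N' : IntegralRep m'), m' ≤ 8 → N.domain = {x | ∀ i, x i ∈ Set.Ioo (0:ℝ) 1} → N.IsRational → N'.domain = {x | ∀ i, x i ∈ Set.Ioo (0:ℝ) 1} → N'.IsRational → N.value = N'.value → Equivalent N N' :=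
  stub_boxRigidity_var2299_of_parent (leaves_of_statement h).1

end Summit.KontsevichZagierPeriods.KontsevichZagierPeriods.Theorems

end
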